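import Summits.HodgeConjecture.HodgeConjecture.Theorems.K2LiuUndoublingSeparationPureTensor
import Literature.NumberTheory.Automorphic.Liu2021.ThetaLiftFromLineMajorants
import HarnessLib

/-!
# Undoubling + separation for a pure tensor FROM SIGN DATA on `d_V`: the nine Weil majorants of the chain and the permutation isometry supplied —
# organ (O44j) of socket #44∕45R (assembly Step 8, `K2/K2Liu-p03/g3/ROAD-44-45R-Assembly`)

Track B ∕ hLiu418 = stmt-HodgeConjecture-24832, line `K2_Liu_CurveThetaSigs`, unit U6, socket #44∕45R `sig_K2LiuUndoublingSeparation` (ED. 7: sign binders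
`(ι₁, h₁V, hV)` on `d_V`, LEAD F0P6-plan ruling 2026-09-04 01:42Z (c1)); seat `hodgecm-mathlib-K2Liu-p03` (g3).  ★
`K2LiuUndoublingSeparationPureTensor.exists_undoubledPairing_ne_zero_of_pureTensor` asks for the permutation isometry `B` and Weil majorants at the eight rank-2
data of the chain (frames `F₁ = d^𝔻 ∘ castAdd = d_V ∘ σ`, `F₂ = d^𝔻 ∘ natAdd = −F₁`, `(−1)•F₁`, `d_V`; lines `a′, (−1)a′, −a′`; characters `λ^{∓1}`).  Sign
data is stable under permuting and negating a frame (§1), so ★ `hasThetaMajorants_lineThetaKernelDatum` supplies all eight from `(ι₁, h₁V, hV)` (§2), and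
`B := ⟨P_x, P_{x⁻¹}⟩` with `x = e₁⁻¹ ≫ fst` (§2):

* §1 `signs_of_eq_comp_equiv`, `signs_of_eq_neg` — transport of the sign data `(h₁V, hV)` along `F = d_V ∘ σ` and `F = −d_V`;
  `coe_neg_one_units`, `dD_castAdd_eq_comp`, `dD_natAdd_eq_neg`, `neg_one_smul_dD_castAdd_eq_neg` — the three chain frames in these shapes;
* §2 `exists_GL_coe_eq_permMatrix` — a permutation matrix as an element of `GL₂(L)`;
  **`exists_undoubledPairing_ne_zero_of_pureTensor_of_signs`** — the package of ★ `exists_undoubledPairing_ne_zero_of_pureTensor` with ONLY the doubled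
  majorant `hρD` (the hypothesis' own) and the sign data as inputs; the conclusion's majorant is the literal ★
  `hasThetaMajorants_lineThetaKernelDatum L e₁ dV hdV hdV0 lam hlam (−a′) ι₁ h₁V hV`. [cite: Weil1964, Chap. III n° 41 Lemme 5 p. 194, Thm. 6 (1) p. 193]
  [cite: HarrisKudlaSweet1996, §1 Lem. 1.1 p. 953, (1.30)] [cite: Liu2021, App. B (B.7) p. 104, Cor. B.5 (3); App. D §D.1 Steps 1–2]

No definition, no instance, no named fact, no `sorry`; axioms ⊆ {propext, Classical.choice, Quot.sound}.

## References
* [Weil1964] A. Weil, Acta Math. 111 (1964), Chap. III n° 41 Lemme 5 p. 194, Thm. 6 p. 193.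
* [HarrisKudlaSweet1996] M. Harris, S. Kudla, W. J. Sweet, J. AMS 9 (1996), §1 Lem. 1.1 p. 953, (1.25)–(1.30), Lem. 1.3.
* [Liu2021] Y. Liu, Camb. J. Math. 9 (2021), App. B (B.7) p. 104, Cor. B.5 (3); App. D §D.1.
* [GetzHahn2024] J. Getz, H. Hahn, GTM 300 (2024), §2.6 Thm. 2.6.2.

HONEST LABEL: HC_CM is proved only modulo the 7 printed citations (2 remaining named inputs: hLiu418 = stmt-HodgeConjecture-24832, h413 =
stmt-HodgeConjecture-24833) until rung 0 closes; this helper moves no counter.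
-/

set_option autoImplicit false

set_option linter.dupNamespace false

noncomputable section

open scoped Classical
open scoped Matrix Kronecker ComplexConjugate
open NumberField IsDedekindDomain MeasureTheory Filter Set
open Literature.RepresentationTheory.HeisenbergGroup
open Literature.NumberTheory.Automorphic
open Literature.NumberTheory.Weil1964
open Literature.NumberTheory.GaloisRepresentations
open Literature.RepresentationTheory.HarrisKudlaSweet1996

namespace Summit.HodgeConjecture.HodgeConjecture.Cruxes.HLiu418.K2LiuUndoublingSeparationOfSigns

open Literature.NumberTheory.Automorphic.UnitaryGroup
open Literature.NumberTheory.Automorphic.IdeleClassGroup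
open Literature.NumberTheory.GelbartRogawski1991 Literature.NumberTheory.GelbartRogawski1991.UnitaryDualPair
open Literature.NumberTheory.GelbartRogawski1991.GRConstruction
open Literature.NumberTheory.Automorphic.Liu2021 Literature.NumberTheory.Automorphic.Liu2021.Def411WeilCarriers
open Literature.NumberTheory.Automorphic.Liu2021.Def411WeilCarriersDoubling
open Literature.NumberTheory.K2Lit.DoubledLineTheta Literature.NumberTheory.K2Lit.SiegelDoubled
open Literature.RepresentationTheory.Liu2021
open Literature.NumberTheory.Automorphic.UnitaryGroup.CotangentForms (toQuotFun)
open Summit.HodgeConjecture.HodgeConjecture.Cruxes.HLiu418.K2LiuConjugateSymplecticInv (IsConjugateSymplectic.inv)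
open Summit.HodgeConjecture.HodgeConjecture.Cruxes.HLiu418.K2LiuSlotOnePermutationFrame (dD_castAdd_apply)
open Summit.HodgeConjecture.HodgeConjecture.Cruxes.HLiu418.K2LiuSlotTwoPermutationFrame (dD_natAdd_eq_neg_one_smul_castAdd)
open Summit.HodgeConjecture.HodgeConjecture.Cruxes.HLiu418.K2LiuUndoublingSeparationPureTensor

variable (L : Type) [Field L] [NumberField L] [IsCMField L]

/-! ## §1 Sign data under permutation and negation of the frame -/

section Signs

variable {N : ℕ}

omit [NumberField L] [IsCMField L] in
/-- **sign data is stable under permuting the frame**: if `F = d_V ∘ σ` then `(h₁V, hV)` for `d_V` give the same for `F` (exceptional index `σ⁻¹ i₀`).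
[cite: Weil1964, Chap. III n° 41 Lemme 5 p. 194] -/
theorem signs_of_eq_comp_equiv (dV F : Fin N → L) (σ : Fin N ≃ Fin N) (hF : ∀ i, F i = dV (σ i)) (ι₁ : L →+* ℂ)
    (h₁V : ∃ i₀ : Fin N, (∀ i, i ≠ i₀ → 0 < (ι₁ (dV i)).re) ∨ ∀ i, i ≠ i₀ → (ι₁ (dV i)).re < 0)
    (hV : ∀ τ : L →+* ℂ, InfinitePlace.mk τ ≠ InfinitePlace.mk ι₁ → (∀ i, 0 < (τ (dV i)).re) ∨ ∀ i, (τ (dV i)).re < 0) :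
    (∃ i₀ : Fin N, (∀ i, i ≠ i₀ → 0 < (ι₁ (F i)).re) ∨ ∀ i, i ≠ i₀ → (ι₁ (F i)).re < 0) ∧
      ∀ τ : L →+* ℂ, InfinitePlace.mk τ ≠ InfinitePlace.mk ι₁ → (∀ i, 0 < (τ (F i)).re) ∨ ∀ i, (τ (F i)).re < 0 := by
  obtain ⟨i₀, h⟩ := h₁V
  have hne : ∀ i, i ≠ σ.symm i₀ → σ i ≠ i₀ := fun i hi h' => hi (by rw [← h', Equiv.symm_apply_apply])
  refine ⟨⟨σ.symm i₀, h.imp (fun h' i hi => ?_) (fun h' i hi => ?_)⟩, fun τ hτ => (hV τ hτ).imp (fun h' i => ?_) (fun h' i => ?_)⟩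
  · rw [hF]; exact h' _ (hne i hi)
  · rw [hF]; exact h' _ (hne i hi)
  · rw [hF]; exact h' _
  · rw [hF]; exact h' _

omit [NumberField L] [IsCMField L] in
/-- **sign data is stable under negating the frame** (`Re ι(−x) = −Re ι(x)` swaps the two alternatives). [cite: Weil1964, Chap. III n° 41 Lemme 5 p. 194] -/
theorem signs_of_eq_neg (dV F : Fin N → L) (hF : ∀ i, F i = -dV i) (ι₁ : L →+* ℂ)
    (h₁V : ∃ i₀ : Fin N, (∀ i, i ≠ i₀ → 0 < (ι₁ (dV i)).re) ∨ ∀ i, i ≠ i₀ → (ι₁ (dV i)).re < 0)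
    (hV : ∀ τ : L →+* ℂ, InfinitePlace.mk τ ≠ InfinitePlace.mk ι₁ → (∀ i, 0 < (τ (dV i)).re) ∨ ∀ i, (τ (dV i)).re < 0) :
    (∃ i₀ : Fin N, (∀ i, i ≠ i₀ → 0 < (ι₁ (F i)).re) ∨ ∀ i, i ≠ i₀ → (ι₁ (F i)).re < 0) ∧
      ∀ τ : L →+* ℂ, InfinitePlace.mk τ ≠ InfinitePlace.mk ι₁ → (∀ i, 0 < (τ (F i)).re) ∨ ∀ i, (τ (F i)).re < 0 := by
  have hre : ∀ (τ : L →+* ℂ) (i), (τ (F i)).re = -(τ (dV i)).re := fun τ i => by rw [hF, map_neg, Complex.neg_re]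
  obtain ⟨i₀, h⟩ := h₁V
  refine ⟨⟨i₀, ?_⟩, fun τ hτ => ?_⟩
  · rcases h with h | h
    · exact Or.inr fun i hi => by rw [hre]; exact neg_lt_zero.mpr (h i hi)
    · exact Or.inl fun i hi => by rw [hre]; exact neg_pos.mpr (h i hi)
  · rcases hV τ hτ with h | h
    · exact Or.inr fun i => by rw [hre]; exact neg_lt_zero.mpr (h i)
    · exact Or.inl fun i => by rw [hre]; exact neg_pos.mpr (h i)

end Signs

/-! ### The three chain frames in these shapes -/

section Frames

variable (e₁ : Fin 2 × Fin 1 ≃ Fin 2) (dV : Fin 2 → L) (hdV : ∀ i, IsCMField.complexConj L (dV i) = dV i)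

omit [NumberField L] [IsCMField L] in
/-- `((−1 : (L⁺)ˣ) : L) = −1`. [folklore] -/
theorem coe_neg_one_units : (((-1 : (Fp L)ˣ) : Fp L) : L) = -1 := by
  rw [Units.val_neg, Units.val_one, NegMemClass.coe_neg, OneMemClass.coe_one]

/-- `F₁ = d^𝔻 ∘ castAdd = d_V ∘ (e₁⁻¹ ≫ fst)` (★ `dD_castAdd_apply`). [cite: HarrisKudlaSweet1996, §1 (1.25)] -/
theorem dD_castAdd_eq_comp (i : Fin 2) :
    dD L e₁ dV hdV (fun _ : Fin 1 => (1 : L)) (fun _ => map_one _) (Fin.castAdd 2 i) = dV ((e₁.symm.trans (Equiv.prodUnique (Fin 2) (Fin 1))) i) := by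
  rw [dD_castAdd_apply, mul_one]
  rfl

/-- `F₂ = d^𝔻 ∘ natAdd = −F₁` (★ `dD_natAdd_eq_neg_one_smul_castAdd`). [cite: HarrisKudlaSweet1996, §1 (1.25)] -/
theorem dD_natAdd_eq_neg (i : Fin 2) :
    dD L e₁ dV hdV (fun _ : Fin 1 => (1 : L)) (fun _ => map_one _) (Fin.natAdd 2 i) =
      -dD L e₁ dV hdV (fun _ : Fin 1 => (1 : L)) (fun _ => map_one _) (Fin.castAdd 2 i) := by
  have h : dD L e₁ dV hdV (fun _ : Fin 1 => (1 : L)) (fun _ => map_one _) (Fin.natAdd 2 i) =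
      (((-1 : (Fp L)ˣ) : Fp L) : L) * dD L e₁ dV hdV (fun _ : Fin 1 => (1 : L)) (fun _ => map_one _) (Fin.castAdd 2 i) :=
    congrFun (dD_natAdd_eq_neg_one_smul_castAdd L e₁ dV hdV) i
  rw [h, coe_neg_one_units, neg_one_mul]

omit [NumberField L] [IsCMField L] in
/-- `(−1) • F = −F` for the units scalar `−1 ∈ (L⁺)ˣ`. [folklore] -/
theorem neg_one_units_mul_eq_neg (F : Fin 2 → L) (i : Fin 2) : (((-1 : (Fp L)ˣ) : Fp L) : L) * F i = -F i := by
  rw [coe_neg_one_units, neg_one_mul]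

end Frames

/-! ## §2 The package from sign data -/

section Package

omit [NumberField L] [IsCMField L] in
/-- **a permutation matrix as an element of `GL₂(L)`**: `B = ⟨P_x, P_{x⁻¹}⟩` with `(B : Matrix) = permMatrix x` (Mathlib `Matrix.permMatrix_mul`,
`permMatrix_one`). [folklore] -/
theorem exists_GL_coe_eq_permMatrix (x : Equiv.Perm (Fin 2)) : ∃ B : GL (Fin 2) L, (B : Matrix (Fin 2) (Fin 2) L) = Equiv.Perm.permMatrix L x :=
  ⟨⟨Equiv.Perm.permMatrix L x, Equiv.Perm.permMatrix L x⁻¹, by rw [← Matrix.permMatrix_mul, inv_mul_cancel, Matrix.permMatrix_one],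
    by rw [← Matrix.permMatrix_mul, mul_inv_cancel, Matrix.permMatrix_one]⟩, rfl⟩

variable (H : Matrix (Fin 2) (Fin 2) L) (e₁ : Fin 2 × Fin 1 ≃ Fin 2) {n'' : ℕ} (e₂ : Fin (2 + 2) × Fin 1 ≃ Fin n'')
  (dV : Fin 2 → L) (hdV : ∀ i, IsCMField.complexConj L (dV i) = dV i) (hdV0 : ∀ i, dV i ≠ 0)

/-- **UNDOUBLING + SEPARATION FOR A PURE TENSOR, FROM SIGN DATA** — ★ `exists_undoubledPairing_ne_zero_of_pureTensor` with the permutation isometry and the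
eight rank-2 Weil majorants of the chain SUPPLIED from `(ι₁, h₁V, hV)` (§1 + ★ `hasThetaMajorants_lineThetaKernelDatum`); the only majorant input left is the
hypothesis' own doubled `hρD`.  The conclusion's kernel datum is `lineThetaKernelDatum L 2 e₁ dV hdV hdV0 lam hlam (−a′) (hasThetaMajorants_lineThetaKernelDatum L e₁
dV hdV hdV0 lam hlam (−a′) ι₁ h₁V hV)` — the socket's `∃ a′ hρ, …` at `a′ ↦ −a′`. [cite: HarrisKudlaSweet1996, §1 Lem. 1.1 p. 953, (1.30), Lem. 1.3]
[cite: Liu2021, App. B (B.7) p. 104, Cor. B.5 (3), Lem. B.11; App. D §D.1 Steps 1–2] [cite: Weil1964, Chap. III n° 41 Lemme 5 p. 194] -/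
theorem exists_undoubledPairing_ne_zero_of_pureTensor_of_signs (ι₁ : L →+* ℂ)
    (h₁V : ∃ i₀ : Fin 2, (∀ i, i ≠ i₀ → 0 < (ι₁ (dV i)).re) ∨ ∀ i, i ≠ i₀ → (ι₁ (dV i)).re < 0)
    (hV : ∀ τ : L →+* ℂ, InfinitePlace.mk τ ≠ InfinitePlace.mk ι₁ → (∀ i, 0 < (τ (dV i)).re) ∨ ∀ i, (τ (dV i)).re < 0)
    (lam : Literature.NumberTheory.Automorphic.IdeleClassGroup L →ₜ* Circle) (hlam : IsConjugateSymplectic L lam) (a' : (Fp L)ˣ)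
    (hρD : HasThetaMajorants fun
      (p : ↥(UnitaryGroup.adelic (Fp L) L (IsCMField.complexConj L) (2 + 2) (Matrix.diagonal (dD L e₁ dV hdV (fun _ : Fin 1 => (1 : L)) (fun _ => map_one _)))) ×
        ↥(UnitaryGroup.adelic (Fp L) L (IsCMField.complexConj L) 1 (JW (Fp L) L a')))
      (Φ : piSchwartzBruhat (Fp L) (Fin n'')) =>
        pairRep (Fp L) L (IsCMField.complexConj L) (2 + 2) 1 e₂ (Matrix.diagonal (dD L e₁ dV hdV (fun _ : Fin 1 => (1 : L)) (fun _ => map_one _))) (JW (Fp L) L a')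
          (chiSplittingLine L e₂ (dD L e₁ dV hdV (fun _ : Fin 1 => (1 : L)) (fun _ => map_one _)) (dD_conj L e₁ dV hdV (fun _ : Fin 1 => (1 : L)) (fun _ => map_one _)) (dD_ne_zero L e₁ dV hdV (fun _ : Fin 1 => (1 : L)) (fun _ => map_one _) hdV0 (fun _ => one_ne_zero))
            (toHeckeCharacter L lam⁻¹) (isUnitary_toHeckeCharacter L lam⁻¹)
            ((isOscillatorChar_toHeckeCharacter_iff lam⁻¹).mpr (IsConjugateSymplectic.inv hlam)) (TW (Fp L) a')
            (isUnit_det_TW (Fp L) a') (JW (Fp L) L a') (JW_eq (Fp L) L a'))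
          p Φ)
    (μ : Measure (adelicGroupData (Fp L) L (IsCMField.complexConj L) 2 H).automorphicQuotient) [IsFiniteMeasure μ]
    (ιA : (adelicGroupData (Fp L) L (IsCMField.complexConj L) 2 H).Adelic →* ↥(UnitaryGroup.adelic (Fp L) L (IsCMField.complexConj L) 2 (Matrix.diagonal dV)))
    (hιAc : Continuous ιA)
    (hιAr : ∀ ⦃γ : (adelicGroupData (Fp L) L (IsCMField.complexConj L) 2 H).Adelic⦄, γ ∈ (UnitaryGroup.toAdelic (Fp L) L (IsCMField.complexConj L) 2 H).range →
      ιA γ ∈ (UnitaryGroup.toAdelic (Fp L) L (IsCMField.complexConj L) 2 (Matrix.diagonal dV)).range)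
    [CompactSpace (adelicGroupData (Fp L) L (IsCMField.complexConj L) 2 H).automorphicQuotient]
    [MeasurableSpace (↥(UnitaryGroup.adelic (Fp L) L (IsCMField.complexConj L) 1 (JW (Fp L) L a')) ⧸ (UnitaryGroup.toAdelic (Fp L) L (IsCMField.complexConj L) 1 (JW (Fp L) L a')).range)] [BorelSpace (↥(UnitaryGroup.adelic (Fp L) L (IsCMField.complexConj L) 1 (JW (Fp L) L a')) ⧸ (UnitaryGroup.toAdelic (Fp L) L (IsCMField.complexConj L) 1 (JW (Fp L) L a')).range)]
    [MeasurableSpace (↥(UnitaryGroup.adelic (Fp L) L (IsCMField.complexConj L) 1 (JW (Fp L) L (-a'))) ⧸ (UnitaryGroup.toAdelic (Fp L) L (IsCMField.complexConj L) 1 (JW (Fp L) L (-a'))).range)] [BorelSpace (↥(UnitaryGroup.adelic (Fp L) L (IsCMField.complexConj L) 1 (JW (Fp L) L (-a'))) ⧸ (UnitaryGroup.toAdelic (Fp L) L (IsCMField.complexConj L) 1 (JW (Fp L) L (-a'))).range)]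
    (μW : Measure (↥(UnitaryGroup.adelic (Fp L) L (IsCMField.complexConj L) 1 (JW (Fp L) L a')) ⧸ (UnitaryGroup.toAdelic (Fp L) L (IsCMField.complexConj L) 1 (JW (Fp L) L a')).range)) [IsFiniteMeasure μW]
    [SMulInvariantMeasure (↥(UnitaryGroup.adelic (Fp L) L (IsCMField.complexConj L) 1 (JW (Fp L) L a'))) (↥(UnitaryGroup.adelic (Fp L) L (IsCMField.complexConj L) 1 (JW (Fp L) L a')) ⧸ (UnitaryGroup.toAdelic (Fp L) L (IsCMField.complexConj L) 1 (JW (Fp L) L a')).range) μW]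
    (f : C(↥(UnitaryGroup.adelic (Fp L) L (IsCMField.complexConj L) 1 (JW (Fp L) L a')) ⧸ (UnitaryGroup.toAdelic (Fp L) L (IsCMField.complexConj L) 1 (JW (Fp L) L a')).range, ℂ)) (w₁ w₂ : (adelicGroupData (Fp L) L (IsCMField.complexConj L) 2 H).automorphicQuotient → ℂ) (hw₂ : Integrable w₂ μ)
    (Φ₁ Φ₂ : piSchwartzBruhat (Fp L) (Fin 2))
    (hne : doublingPairing (adelicGroupData (Fp L) L (IsCMField.complexConj L) 2 H) μ
        (toQuotFun₂ (adelicGroupData (Fp L) L (IsCMField.complexConj L) 2 H)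
          (fun g => doubledLineThetaLift L e₁ dV hdV (fun _ : Fin 1 => (1 : L)) (fun _ => map_one _) e₂ hdV0 (fun _ => one_ne_zero) lam⁻¹
            (IsConjugateSymplectic.inv hlam) a' hρD μW (sumTensor (Fp L) (idxSplit e₂ e₁ e₁) Φ₁ Φ₂) f
            (iotaV L e₁ dV hdV (fun _ : Fin 1 => (1 : L)) (fun _ => map_one _) (ιA g.1, ιA g.2))))
        w₁ w₂ ≠ 0) :
    ∃ (ν : Measure (↥(UnitaryGroup.adelic (Fp L) L (IsCMField.complexConj L) 1 (JW (Fp L) L (-a'))) ⧸ (UnitaryGroup.toAdelic (Fp L) L (IsCMField.complexConj L) 1 (JW (Fp L) L (-a'))).range)) (_ : IsFiniteMeasure ν) (_ : SMulInvariantMeasure (↥(UnitaryGroup.adelic (Fp L) L (IsCMField.complexConj L) 1 (JW (Fp L) L (-a')))) (↥(UnitaryGroup.adelic (Fp L) L (IsCMField.complexConj L) 1 (JW (Fp L) L (-a'))) ⧸ (UnitaryGroup.toAdelic (Fp L) L (IsCMField.complexConj L) 1 (JW (Fp L) L (-a'))).range) ν) (_ : ν.IsOpenPosMeasure)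
      (Ψ₁ Ψ₂ : piSchwartzBruhat (Fp L) (Fin 2)) (f' : C(↥(UnitaryGroup.adelic (Fp L) L (IsCMField.complexConj L) 1 (JW (Fp L) L (-a'))) ⧸ (UnitaryGroup.toAdelic (Fp L) L (IsCMField.complexConj L) 1 (JW (Fp L) L (-a'))).range, ℂ)) (W₂ : (adelicGroupData (Fp L) L (IsCMField.complexConj L) 2 H).automorphicQuotient → ℂ),
      Integrable W₂ μ ∧
      doublingPairing (adelicGroupData (Fp L) L (IsCMField.complexConj L) 2 H) μ
        (fun x => ∫ q, f' q * (starRingEnd ℂ (toQuotFun (adelicGroupData (Fp L) L (IsCMField.complexConj L) 2 H)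
            (fun y => (lineThetaKernelDatum L 2 e₁ dV hdV hdV0 lam hlam (-a')
              (hasThetaMajorants_lineThetaKernelDatum L e₁ dV hdV hdV0 lam hlam (-a') ι₁ h₁V hV)).thetaKer Ψ₁ (QuotientGroup.mk (ιA y)⁻¹, q)) x.1) *
          toQuotFun (adelicGroupData (Fp L) L (IsCMField.complexConj L) 2 H) (fun y => (lineThetaKernelDatum L 2 e₁ dV hdV hdV0 lam hlam (-a')
              (hasThetaMajorants_lineThetaKernelDatum L e₁ dV hdV hdV0 lam hlam (-a') ι₁ h₁V hV)).thetaKer Ψ₂ (QuotientGroup.mk (ιA y)⁻¹, q)) x.2) ∂ν)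
        w₁ W₂ ≠ 0 := by
  -- the permutation isometry
  obtain ⟨B, hBval⟩ := exists_GL_coe_eq_permMatrix L (e₁.symm.trans (Equiv.prodUnique (Fin 2) (Fin 1)))
  -- sign data for the three chain frames
  obtain ⟨h₁F₁, hF₁⟩ := signs_of_eq_comp_equiv L dV (fun i => dD L e₁ dV hdV (fun _ : Fin 1 => (1 : L)) (fun _ => map_one _) (Fin.castAdd 2 i)) (e₁.symm.trans (Equiv.prodUnique (Fin 2) (Fin 1)))
    (dD_castAdd_eq_comp L e₁ dV hdV) ι₁ h₁V hV
  obtain ⟨h₁F₂, hF₂⟩ := signs_of_eq_neg L (fun i => dD L e₁ dV hdV (fun _ : Fin 1 => (1 : L)) (fun _ => map_one _) (Fin.castAdd 2 i)) (fun i => dD L e₁ dV hdV (fun _ : Fin 1 => (1 : L)) (fun _ => map_one _) (Fin.natAdd 2 i)) (dD_natAdd_eq_neg L e₁ dV hdV) ι₁ h₁F₁ hF₁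
  obtain ⟨h₁cF₁, hcF₁⟩ := signs_of_eq_neg L (fun i => dD L e₁ dV hdV (fun _ : Fin 1 => (1 : L)) (fun _ => map_one _) (Fin.castAdd 2 i)) (fun i => (((-1 : (Fp L)ˣ) : Fp L) : L) * (fun i => dD L e₁ dV hdV (fun _ : Fin 1 => (1 : L)) (fun _ => map_one _) (Fin.castAdd 2 i)) i)
    (neg_one_units_mul_eq_neg L (fun i => dD L e₁ dV hdV (fun _ : Fin 1 => (1 : L)) (fun _ => map_one _) (Fin.castAdd 2 i))) ι₁ h₁F₁ hF₁
  -- the package, all eight rank-2 majorants from ★ `hasThetaMajorants_lineThetaKernelDatum`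
  exact exists_undoubledPairing_ne_zero_of_pureTensor L H e₁ e₂ dV hdV hdV0 lam hlam a' B hBval hρD
    (hasThetaMajorants_lineThetaKernelDatum L e₁ _ _ _ lam⁻¹ (IsConjugateSymplectic.inv hlam) a' ι₁ h₁F₁ hF₁)
    (hasThetaMajorants_lineThetaKernelDatum L e₁ dV hdV hdV0 lam⁻¹ (IsConjugateSymplectic.inv hlam) a' ι₁ h₁V hV)
    (hasThetaMajorants_lineThetaKernelDatum L e₁ _ _ _ lam⁻¹ (IsConjugateSymplectic.inv hlam) a' ι₁ h₁F₂ hF₂)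
    (hasThetaMajorants_lineThetaKernelDatum L e₁ _ _ _ lam⁻¹ (IsConjugateSymplectic.inv hlam) a' ι₁ h₁cF₁ hcF₁)
    (hasThetaMajorants_lineThetaKernelDatum L e₁ _ _ _ lam⁻¹ (IsConjugateSymplectic.inv hlam) ((-1 : (Fp L)ˣ) * a') ι₁ h₁F₁ hF₁)
    (hasThetaMajorants_lineThetaKernelDatum L e₁ dV hdV hdV0 lam⁻¹ (IsConjugateSymplectic.inv hlam) ((-1 : (Fp L)ˣ) * a') ι₁ h₁V hV)
    (hasThetaMajorants_lineThetaKernelDatum L e₁ dV hdV hdV0 lam⁻¹ (IsConjugateSymplectic.inv hlam) (-a') ι₁ h₁V hV)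
    (hasThetaMajorants_lineThetaKernelDatum L e₁ dV hdV hdV0 lam hlam (-a') ι₁ h₁V hV)
    μ ιA hιAc hιAr μW f w₁ w₂ hw₂ Φ₁ Φ₂ hne

end Package

end Summit.HodgeConjecture.HodgeConjecture.Cruxes.HLiu418.K2LiuUndoublingSeparationOfSigns

end
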